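import Summits.QuantumFields.YangMills.Theorems.BalabanUVNodesN16KingModelTwoRunDeriv

/-!
# Route «BalabanUVNodes» (K3⁵ `SpineGivenEndpointR13SepCoP`), DAG node N16 = NE3 — THE KING-MODEL RUNG OF NE3, DERIVATIVE LINE,
# PART 3: the SUP-NORM form on BAŁABAN's VOLUMES — the lattice derivative of the two-run minimiser discrepancy decays at King's
# geometric rate `(L^{−γ∕2})^K` with ONE level-free AND volume-free constant (King 1986 Prop. 3.8 (3.71) lines 2 and 4 «combined
# with Theorem 3.3», BY NAME) — the scalar template of NE3's conjunct (Lip₁ᶜ), unconditional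

Cell `pub-ymgap`, seat `pub-ymgap-dag-n16-c` (R134 acceleration seat, strategy s1; HUMAN RULING D-0062; chair R424 venue), generation 8.
`--kind proof --supports stmt-QuantumFields-20296 --as helper` (K3⁵, plan g68 KEY-20 ∕ dag-lead WORDS-141).  `bears_on: R4∕N16 · row «R2^ϱ,
the unprinted core»`.

WHY THIS FILE.  PART 2 (`BalabanUVNodesN16KingModelTwoRunDeriv`) bounds the derivative of the two-run discrepancy
`∂^η_μ(ℋ_k(·, b) − Q_nℋ_{k+n}(·, b))(x)` on EVERY volume by `(C₅′ + H_γ)·(L^{−γ})^k` per unit site `b` (hence `·Σ_b|ψ(b)|` for a datum).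
On Bałaban's volumes (`M_μ = 2Lᵐ`, the `B1∕B4` tower tori on which seat n18-b certified Theorem 3.3's decay for King's ACTUAL operators)
the per-site bounds DECAY in the block distance `|B(x) − b|`: King's (3.71) line 2 in block-distance currency
(`MinimizerTwoSpacingDeriv.king_prop38_deriv_torus_blocks`, constant made level-free by `N18KingModelTorusDeriv.douterRate_le_unif`) and
line 4 ∕ Theorem 3.3 (3.8) for the Hölder quotient of the derivative (`MinimizerHolderDecay.holder_dkernel_decay_blocks` at `α = γ∕2`) — so
the sum over the unit torus is uniform (`UniformDecay.tdistT_sumBound`) and the datum enters through `sup|ψ|`.  The fine points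
`x′ + j·e_μ` read by the derivative of the block mean (PART 1, `N16KingModelBlockShift.coarseDeriv_blockMean_eq`) lie over `x` or over
`x + e_μ` (`over_add_nsmul_cases`); both blocks' decay profiles are summed (whence the factors `2`).

WHAT THIS FILE PROVES (kernel; 2 theorems, 0 `def`, 0 sorry):
* §1 ★★ `twoRunDeriv_minimiser_blockMean_le_sup` — for `d ≥ 1`, odd `L ≥ 2`, `a, m² > 0`, `0 < γ < 1` there are `δ₀, c₀, δ₁, c₁ > 0`
  (functions of `d, L, a, m², γ` only) with, for EVERY volume `P = (d, L, m, K)`, `K ≥ 1`, every `n ≥ 1`, every datum `|ψ| ≤ S`, coarse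
  point `x` and direction `μ`:
  `|L^K·((φ_K^ψ − Q_nφ_{K+n}^ψ)(x + e_μ) − (φ_K^ψ − Q_nφ_{K+n}^ψ)(x))| ≤ (2√(2ac₀C₅′)·K_d(δ₀∕2) + 2c₁K_d(δ₁))·(L^{−γ∕2})^K·S`,
  `C₅′ = dprop38RateConst a a Θ (π²∕4)^d d γ + dprop38PosConst a (π²∕4)^d d γ`, `K_d = B4Sect5Proof.latticeConst d`.
* §2 ★★ `twoRun_value_and_firstDiff_le_sup` — THE NE3 PATTERN IN KING's MODEL, VALUE AND FIRST DIFFERENCE TOGETHER: one `C ≥ 0`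
  (function of `d, L, a, m², γ`) with, for every volume, `n`, datum `|ψ| ≤ S`, `x`, `μ`, writing `D = φ_K^ψ − Q_nφ_{K+n}^ψ` and `θ = L^{−γ∕2}`:
  `|D(x)| ≤ C·θ^K·S` (generation 7's `N16KingModel.twoRun_minimiser_blockMean_le_sup`) AND `|D(x + e_μ) − D(x)| ≤ C·(L^K)⁻¹·θ^K·S`
  (§1 divided by `η⁻¹ = L^K`) — the raw first difference carries ONE EXTRA POWER of the lattice spacing `ξ = L^{−K}`, as (Lip₁ᶜ)
  (`≤ Λ₁ξ²` next to a value of size `ξ`-order) words it for Bałaban's `Z`.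

READING FOR ROW N16 (a dictionary, NOT a decl): (Lip₁ᶜ) `‖Ad(W(x+e_κ)μ)Z(x+e_μ)κ − Z x κ‖ ≤ Λ₁ξ²` ↔ `|D(x + e_μ) − D(x)| = L^{−K}·|∂^η_μD(x)|
≤ C·L^{−K}·(L^{−γ∕2})^K·S`: the raw first difference of the scalar discrepancy is ONE POWER OF THE LATTICE SPACING better than generation
7's bound `|D| ≤ C·(L^{−γ∕2})^K·S` on the discrepancy itself — the pattern (Lip₁ᶜ) postulates (abelian: `Ad = id`).  NOT CARRIED: the
gauge `u`, the transport `Ad(W)`, the covariant block average, (Lip₂′ᶜ), Bałaban's axial constraint — everything non-abelian.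

HONEST FRAMING.  A MODEL LAYER (template literature: [King1986] printed AND proved; re-proved in kernel from the tree's King files BY
NAME).  NOTHING of [Balaban1985RegularSpaces] ∕ [Balaban1985Variational] is proved or discharged; N16 ∕ NE3 is NOT discharged (in-edges
N05, N07 remain hypotheses of the chain of record); COUNT UNMOVED; count-neutral; one finite torus at a time — NOT ℝ⁴, NOT infinite
volume, NOT OS, NOT a mass gap, NOT Clay.

Sources: C. King, *The U(1) Higgs model. I. The continuum limit*, Commun. Math. Phys. **102** (1986) 649–677 [King1986], Prop. 3.8
(3.71) p. 664 (lines 2 and 4), Thm 3.3 (3.7)–(3.8) p. 658, p. 674 («combining our bounds with Theorem 3.3»); T. Bałaban, *Regularity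
and decay of lattice Green's functions*, Commun. Math. Phys. **89** (1983) 571–597 [Balaban1983RegularityDecay], Thm (1.10) p. 573.
-/

set_option autoImplicit false

noncomputable section

open Real Finset
open scoped BigOperators

namespace Summit.QuantumFields.YangMills.BalabanUVNodes.N16KingModelDerivSup

open Literature.MathematicalPhysics.QuantumFieldTheory.Balaban1983to89 (Params)
open Literature.MathematicalPhysics.QuantumFieldTheory.Balaban1983to89.B5Prop11Plancherel (Tor fine unitVec)
open Literature.MathematicalPhysics.QuantumFieldTheory.Balaban1983to89.B4Sect5Proof (latticeConst latticeConst_nonneg)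
open Literature.MathematicalPhysics.QuantumFieldTheory.King1986
  (aK aK_pos aK_le lemma43Const prop38RateConst prop38PosConst dprop38RateConst dprop38PosConst aliasConst)
open Literature.MathematicalPhysics.QuantumFieldTheory.King1986.Torus
  (minimiser blockOf tdistT tdistT_nonneg tdistT_sumBound holdist king_prop38_deriv_torus_blocks holder_dkernel_decay_blocks)
open Summit.QuantumFields.YangMills.BalabanUVNodes.N18KingModel (rpow_neg_natPow kingTheta_pos)
open Summit.QuantumFields.YangMills.BalabanUVNodes.N18KingModelTorusDeriv (douterRate_le_unif)
open Summit.QuantumFields.YangMills.BalabanUVNodes.N16KingModel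
  (mem_overFib overFib_nonempty abs_blockMean_sub_le twoRun_minimiser_blockMean_le_sup)
open Summit.QuantumFields.YangMills.BalabanUVNodes.N16KingModelBlockShift (over_add_nsmul_cases coarseDeriv_blockMean_eq)
open Summit.QuantumFields.YangMills.BalabanUVNodes.N16KingModelDeriv
  (abs_le_of_holder_bound holdist_add_unitVec abs_rangeMean_sub_le exp_neg_mul_min_le datum_expand)

variable {d : ℕ}

/-! ## §1 ★★ On Bałaban's volumes: the SUP-NORM derivative of the two-run discrepancy with King's decay — level-free AND volume-free -/

/-- ★★ **NE3's (Lip₁ᶜ) IN KING's MODEL, SUP-NORM FORM, UNCONDITIONAL** (King's Prop. 3.8 (3.71) lines 2 and 4 «combined with Theorem 3.3»,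
averaged over the fibre and over `j < Lⁿ`, summed over the unit torus).  For `d ≥ 1`, odd `L ≥ 2`, `a, m² > 0`, `0 < γ < 1` there are
`δ₀, c₀ > 0` (n18-b's `king_prop38_deriv_torus_blocks`) and `δ₁, c₁ > 0` (n18-b's `holder_dkernel_decay_blocks` at `α = γ∕2`), functions of
`d, L, a, m², γ` only, such that for EVERY volume `P = (d, L, m, K)` of the `B1∕B4` tower with `K ≥ 1` (unit torus `M_μ = 2Lᵐ`), every `n ≥ 1`,
every datum `ψ` with `|ψ| ≤ S`, every coarse point `x` and direction `μ`:
`|∂^η_μ(φ_K^ψ − Q_nφ_{K+n}^ψ)(x)| = |L^K·((φ_K^ψ − Q_nφ_{K+n}^ψ)(x + e_μ) − (φ_K^ψ − Q_nφ_{K+n}^ψ)(x))|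
  ≤ (2√(2ac₀·C₅′(a, L, d, γ))·K_d(δ₀∕2) + 2c₁·K_d(δ₁))·(L^{−γ∕2})^K·S`,
`K_d = B4Sect5Proof.latticeConst d` (`tdistT_sumBound`).  The constant reads NEITHER the level `K` NOR `n` NOR the volume: the scalar
template of (Lip₁ᶜ) — the raw first difference of the discrepancy is `L^{−K}` times this, one power of the lattice spacing better than
generation 7's bound on the discrepancy itself. [cite: King1986, Prop. 3.8 (3.71) p.664, Thm 3.3 (3.7)–(3.8) p.658, p.674;
Balaban1983RegularityDecay, Thm (1.10) p.573] -/
theorem twoRunDeriv_minimiser_blockMean_le_sup (dd L : ℕ) (hd : 1 ≤ dd) (hLodd : Odd L) (hL : 2 ≤ L) {a m2 : ℝ} (ha : 0 < a)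
    (hm : 0 < m2) {γ : ℝ} (hγ0 : 0 < γ) (hγ1 : γ < 1) :
    ∃ δ₀ c₀ δ₁ c₁ : ℝ, 0 < δ₀ ∧ 0 < c₀ ∧ 0 < δ₁ ∧ 0 < c₁ ∧
      ∀ (P : Params) (_hPd : P.d = dd) (_hPL : P.L = L) (_hK : 1 ≤ P.K) [NeZero P.L]
      (n : ℕ) (_hn : 1 ≤ n) (M : Fin P.d → ℕ) [∀ μ, NeZero (M μ)] (_hMK : ∀ μ, M μ = P.sitesPerDir P.K)
      (ψ : Tor M → ℝ) (S : ℝ) (_hS : ∀ b, |ψ b| ≤ S) (xt : Tor (fine (P.L ^ P.K) M)) (μ : Fin P.d),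
      |((P.L ^ P.K : ℕ) : ℝ) *
          ((minimiser (P.L ^ P.K) M (aK a P.L P.K) (((P.L ^ P.K : ℕ) : ℝ) ^ 2) m2 ψ (xt + unitVec (fine (P.L ^ P.K) M) μ)
              - (((Finset.univ.filter fun y : Tor (fine (P.L ^ n * P.L ^ P.K) M) =>
                    ∀ ν, ((xt + unitVec (fine (P.L ^ P.K) M) μ) ν).val = (y ν).val / P.L ^ n).card : ℝ))⁻¹ *
                ∑ y ∈ (Finset.univ.filter fun y : Tor (fine (P.L ^ n * P.L ^ P.K) M) =>
                    ∀ ν, ((xt + unitVec (fine (P.L ^ P.K) M) μ) ν).val = (y ν).val / P.L ^ n),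
                  minimiser (P.L ^ n * P.L ^ P.K) M (aK a P.L (P.K + n)) (((P.L ^ n * P.L ^ P.K : ℕ) : ℝ) ^ 2) m2 ψ y)
            - (minimiser (P.L ^ P.K) M (aK a P.L P.K) (((P.L ^ P.K : ℕ) : ℝ) ^ 2) m2 ψ xt
              - (((Finset.univ.filter fun x' : Tor (fine (P.L ^ n * P.L ^ P.K) M) =>
                    ∀ ν, (xt ν).val = (x' ν).val / P.L ^ n).card : ℝ))⁻¹ *
                ∑ x' ∈ (Finset.univ.filter fun x' : Tor (fine (P.L ^ n * P.L ^ P.K) M) =>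
                    ∀ ν, (xt ν).val = (x' ν).val / P.L ^ n),
                  minimiser (P.L ^ n * P.L ^ P.K) M (aK a P.L (P.K + n)) (((P.L ^ n * P.L ^ P.K : ℕ) : ℝ) ^ 2) m2 ψ x'))|
        ≤ (2 * Real.sqrt (2 * (a * c₀) *
                (dprop38RateConst a a (a * (2 * ((a * (1 - ((L : ℝ) ^ 2)⁻¹))⁻¹ + π ^ 2 / 48 + 1 / 3))) ((π ^ 2 / 4) ^ dd) dd γ
                  + dprop38PosConst a ((π ^ 2 / 4) ^ dd) dd γ)) * latticeConst dd (δ₀ / 2)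
            + 2 * c₁ * latticeConst dd δ₁) * ((L : ℝ) ^ (-(γ / 2))) ^ P.K * S := by
  obtain ⟨δ₀, c₀, hδ₀, hc₀, HK⟩ := king_prop38_deriv_torus_blocks dd L hd hLodd hL ha hm hγ0.le hγ1
  obtain ⟨δ₁, c₁, hδ₁, hc₁, HH⟩ :=
    holder_dkernel_decay_blocks dd L hd hLodd hL ha hm (α := γ / 2) (by linarith) (by linarith)
  refine ⟨δ₀, c₀, δ₁, c₁, hδ₀, hc₀, hδ₁, hc₁, ?_⟩
  intro P hPd hPL hK _ n hn M _ hMK ψ S hS xt μ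
  subst hPd hPL
  -- elementary facts
  have hd0 : 0 < P.d := by omega
  have hL0 : 0 < P.L := by omega
  have hLn : 0 < P.L ^ n := pow_pos hL0 n
  have hN2 : 2 ≤ P.L ^ P.K := by
    calc 2 ≤ P.L := hL
      _ = P.L ^ 1 := (pow_one P.L).symm
      _ ≤ P.L ^ P.K := Nat.pow_le_pow_right hL0 hK
  have hM1 : 1 ≤ M μ := Nat.one_le_iff_ne_zero.mpr (NeZero.ne (M μ))
  have hNM : 2 ≤ P.L ^ P.K * M μ := hN2.trans (Nat.le_mul_of_pos_right _ hM1)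
  have hNpos : (0 : ℝ) < ((P.L ^ P.K : ℕ) : ℝ) := by exact_mod_cast (show 0 < P.L ^ P.K by omega)
  have hS0 : 0 ≤ S := (abs_nonneg _).trans (hS 0)
  -- names: the two rates and the decay profiles around the blocks of `xt` and of `xt + e_μ`
  set Rk : ℝ := Real.sqrt (((dprop38RateConst a a (lemma43Const a P.L P.K n) ((π ^ 2 / 4) ^ P.d) P.d γ
      + dprop38PosConst a ((π ^ 2 / 4) ^ P.d) P.d γ) * ((P.L ^ P.K : ℕ) : ℝ) ^ (-γ)) * (2 * (a * c₀))) with hRk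
  set ρ : ℝ := ((P.L ^ P.K : ℕ) : ℝ) ^ (-(γ / 2)) with hρ
  have hRk0 : 0 ≤ Rk := Real.sqrt_nonneg _
  have hρ0 : 0 ≤ ρ := Real.rpow_nonneg (Nat.cast_nonneg _) _
  set x1 : Tor (fine (P.L ^ P.K) M) := xt + unitVec (fine (P.L ^ P.K) M) μ with hx1
  set E₀ : Tor (fine (P.L ^ P.K) M) → Tor M → ℝ :=
    fun z bt => Real.exp (-(δ₀ / 2 * tdistT M (blockOf (P.L ^ P.K) M z) bt)) with hE₀
  set E₁ : Tor (fine (P.L ^ P.K) M) → Tor M → ℝ :=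
    fun z bt => Real.exp (-(δ₁ * tdistT M (blockOf (P.L ^ P.K) M z) bt)) with hE₁
  have hE₀0 : ∀ z bt, 0 ≤ E₀ z bt := fun z bt => (Real.exp_pos _).le
  have hE₁0 : ∀ z bt, 0 ≤ E₁ z bt := fun z bt => (Real.exp_pos _).le
  -- the Hölder patch with decay: `|∂ℋ_K(xt + e_μ, bt) − ∂ℋ_K(xt, bt)| ≤ c₁·ρ·(E₁(xt + e_μ, bt) + E₁(xt, bt))`
  have hpatch : ∀ bt : Tor M,
      |((P.L ^ P.K : ℕ) : ℝ) *
          (minimiser (P.L ^ P.K) M (aK a P.L P.K) (((P.L ^ P.K : ℕ) : ℝ) ^ 2) m2 (Pi.single bt 1)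
              (x1 + unitVec (fine (P.L ^ P.K) M) μ)
            - minimiser (P.L ^ P.K) M (aK a P.L P.K) (((P.L ^ P.K : ℕ) : ℝ) ^ 2) m2 (Pi.single bt 1) x1)
        - ((P.L ^ P.K : ℕ) : ℝ) *
          (minimiser (P.L ^ P.K) M (aK a P.L P.K) (((P.L ^ P.K : ℕ) : ℝ) ^ 2) m2 (Pi.single bt 1)
              (xt + unitVec (fine (P.L ^ P.K) M) μ)
            - minimiser (P.L ^ P.K) M (aK a P.L P.K) (((P.L ^ P.K : ℕ) : ℝ) ^ 2) m2 (Pi.single bt 1) xt)|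
        ≤ c₁ * ρ * (E₁ x1 bt + E₁ xt bt) := by
    intro bt
    have h := HH P rfl rfl hK M hMK (P.L ^ P.K) rfl x1 xt bt μ
    rw [hx1, holdist_add_unitVec hNM xt] at h
    have h2 := abs_le_of_holder_bound (inv_pos.2 hNpos) h
    rw [Real.inv_rpow hNpos.le, ← Real.rpow_neg hNpos.le] at h2
    refine h2.trans ?_
    have h3 := exp_neg_mul_min_le δ₁ (tdistT M (blockOf (P.L ^ P.K) M x1) bt) (tdistT M (blockOf (P.L ^ P.K) M xt) bt)
    calc c₁ * Real.exp (-(δ₁ * min (tdistT M (blockOf (P.L ^ P.K) M (xt + unitVec (fine (P.L ^ P.K) M) μ)) bt)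
            (tdistT M (blockOf (P.L ^ P.K) M xt) bt))) * ((P.L ^ P.K : ℕ) : ℝ) ^ (-(γ / 2))
        = c₁ * ρ * Real.exp (-(δ₁ * min (tdistT M (blockOf (P.L ^ P.K) M x1) bt)
            (tdistT M (blockOf (P.L ^ P.K) M xt) bt))) := by rw [hρ, hx1]; ring
      _ ≤ c₁ * ρ * (E₁ x1 bt + E₁ xt bt) := mul_le_mul_of_nonneg_left h3 (mul_nonneg hc₁.le hρ0)
  -- the per-kernel bound: `|∂D_bt(xt)| ≤ β(bt)` with `β(bt) = Rk·(E₀ xt + E₀ x1) + c₁ρ·(E₁ x1 + E₁ xt)`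
  have hker : ∀ bt : Tor M,
      |((P.L ^ P.K : ℕ) : ℝ) *
          ((minimiser (P.L ^ P.K) M (aK a P.L P.K) (((P.L ^ P.K : ℕ) : ℝ) ^ 2) m2 (Pi.single bt 1) x1
              - (((Finset.univ.filter fun y : Tor (fine (P.L ^ n * P.L ^ P.K) M) =>
                    ∀ ν, (x1 ν).val = (y ν).val / P.L ^ n).card : ℝ))⁻¹ *
                ∑ y ∈ (Finset.univ.filter fun y : Tor (fine (P.L ^ n * P.L ^ P.K) M) =>
                    ∀ ν, (x1 ν).val = (y ν).val / P.L ^ n),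
                  minimiser (P.L ^ n * P.L ^ P.K) M (aK a P.L (P.K + n)) (((P.L ^ n * P.L ^ P.K : ℕ) : ℝ) ^ 2) m2
                    (Pi.single bt 1) y)
            - (minimiser (P.L ^ P.K) M (aK a P.L P.K) (((P.L ^ P.K : ℕ) : ℝ) ^ 2) m2 (Pi.single bt 1) xt
              - (((Finset.univ.filter fun x' : Tor (fine (P.L ^ n * P.L ^ P.K) M) =>
                    ∀ ν, (xt ν).val = (x' ν).val / P.L ^ n).card : ℝ))⁻¹ *
                ∑ x' ∈ (Finset.univ.filter fun x' : Tor (fine (P.L ^ n * P.L ^ P.K) M) =>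
                    ∀ ν, (xt ν).val = (x' ν).val / P.L ^ n),
                  minimiser (P.L ^ n * P.L ^ P.K) M (aK a P.L (P.K + n)) (((P.L ^ n * P.L ^ P.K : ℕ) : ℝ) ^ 2) m2
                    (Pi.single bt 1) x'))|
        ≤ Rk * (E₀ xt bt + E₀ x1 bt) + c₁ * ρ * (E₁ x1 bt + E₁ xt bt) := by
    intro bt
    -- pointwise at every fine point read by the derivative of the block mean
    have hpt : ∀ x' : Tor (fine (P.L ^ n * P.L ^ P.K) M), (∀ ν, (xt ν).val = (x' ν).val / P.L ^ n) →
        ∀ j ∈ Finset.range (P.L ^ n),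
        |((P.L ^ n * P.L ^ P.K : ℕ) : ℝ) *
            (minimiser (P.L ^ n * P.L ^ P.K) M (aK a P.L (P.K + n)) (((P.L ^ n * P.L ^ P.K : ℕ) : ℝ) ^ 2) m2
                (Pi.single bt 1)
                (x' + j • unitVec (fine (P.L ^ n * P.L ^ P.K) M) μ + unitVec (fine (P.L ^ n * P.L ^ P.K) M) μ)
              - minimiser (P.L ^ n * P.L ^ P.K) M (aK a P.L (P.K + n)) (((P.L ^ n * P.L ^ P.K : ℕ) : ℝ) ^ 2) m2
                (Pi.single bt 1) (x' + j • unitVec (fine (P.L ^ n * P.L ^ P.K) M) μ))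
          - ((P.L ^ P.K : ℕ) : ℝ) *
            (minimiser (P.L ^ P.K) M (aK a P.L P.K) (((P.L ^ P.K : ℕ) : ℝ) ^ 2) m2 (Pi.single bt 1) x1
              - minimiser (P.L ^ P.K) M (aK a P.L P.K) (((P.L ^ P.K : ℕ) : ℝ) ^ 2) m2 (Pi.single bt 1) xt)|
          ≤ Rk * (E₀ xt bt + E₀ x1 bt) + c₁ * ρ * (E₁ x1 bt + E₁ xt bt) := by
      intro x' hx' j hj
      have hjlt : j < P.L ^ n := Finset.mem_range.1 hj
      have hrest : 0 ≤ c₁ * ρ * (E₁ x1 bt + E₁ xt bt) :=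
        mul_nonneg (mul_nonneg hc₁.le hρ0) (add_nonneg (hE₁0 _ _) (hE₁0 _ _))
      rcases over_add_nsmul_cases xt x' hx' μ hjlt with h0 | h1
      · have h := HK P rfl rfl hK n hn M hMK xt _ bt h0 μ
        calc _ ≤ Rk * E₀ xt bt := h
          _ ≤ Rk * (E₀ xt bt + E₀ x1 bt) := mul_le_mul_of_nonneg_left (le_add_of_nonneg_right (hE₀0 _ _)) hRk0
          _ ≤ _ := le_add_of_nonneg_right hrest
      · have h := HK P rfl rfl hK n hn M hMK x1 _ bt h1 μ
        calc _ ≤ Rk * E₀ x1 bt + c₁ * ρ * (E₁ x1 bt + E₁ xt bt) := (abs_sub_le _ _ _).trans (add_le_add h (hpatch bt))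
          _ ≤ _ := by
              have : Rk * E₀ x1 bt ≤ Rk * (E₀ xt bt + E₀ x1 bt) :=
                mul_le_mul_of_nonneg_left (le_add_of_nonneg_left (hE₀0 _ _)) hRk0
              linarith
    have hrew : ∀ A1 Q1 A0 Q0 : ℝ, ((P.L ^ P.K : ℕ) : ℝ) * ((A1 - Q1) - (A0 - Q0))
        = ((P.L ^ P.K : ℕ) : ℝ) * (A1 - A0) - ((P.L ^ P.K : ℕ) : ℝ) * (Q1 - Q0) := by intros; ring
    rw [hrew, hx1, coarseDeriv_blockMean_eq M xt μ
      (minimiser (P.L ^ n * P.L ^ P.K) M (aK a P.L (P.K + n)) (((P.L ^ n * P.L ^ P.K : ℕ) : ℝ) ^ 2) m2 (Pi.single bt 1)),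
      abs_sub_comm]
    exact abs_blockMean_sub_le (overFib_nonempty (by omega) P.K n M xt) fun x' hx' =>
      abs_rangeMean_sub_le hLn (hpt x' (mem_overFib.1 hx'))
  -- sum the decay profiles over the unit torus: four lattice sums, each `≤ K_d`
  have hsum₀ : ∀ z : Tor (fine (P.L ^ P.K) M), ∑ bt : Tor M, E₀ z bt ≤ latticeConst P.d (δ₀ / 2) := fun z =>
    tdistT_sumBound M (δ₀ / 2) (by positivity) (blockOf (P.L ^ P.K) M z)
  have hsum₁ : ∀ z : Tor (fine (P.L ^ P.K) M), ∑ bt : Tor M, E₁ z bt ≤ latticeConst P.d δ₁ := fun z =>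
    tdistT_sumBound M δ₁ hδ₁ (blockOf (P.L ^ P.K) M z)
  have hβsum : ∑ bt : Tor M, (Rk * (E₀ xt bt + E₀ x1 bt) + c₁ * ρ * (E₁ x1 bt + E₁ xt bt))
      ≤ Rk * (2 * latticeConst P.d (δ₀ / 2)) + c₁ * ρ * (2 * latticeConst P.d δ₁) := by
    rw [Finset.sum_add_distrib, ← Finset.mul_sum, ← Finset.mul_sum, Finset.sum_add_distrib, Finset.sum_add_distrib]
    have h0 := hsum₀ xt; have h0' := hsum₀ x1; have h1 := hsum₁ x1; have h1' := hsum₁ xt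
    have := mul_nonneg hc₁.le hρ0
    nlinarith
  -- the uniform rates: `Rk ≤ √(2ac₀C₅′)·(L^{−γ∕2})^K` and `ρ = (L^{−γ∕2})^K`
  have hRk_le : Rk ≤ Real.sqrt (2 * (a * c₀) *
        (dprop38RateConst a a (a * (2 * ((a * (1 - ((P.L : ℝ) ^ 2)⁻¹))⁻¹ + π ^ 2 / 48 + 1 / 3))) ((π ^ 2 / 4) ^ P.d) P.d γ
          + dprop38PosConst a ((π ^ 2 / 4) ^ P.d) P.d γ)) * ((P.L : ℝ) ^ (-(γ / 2))) ^ P.K :=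
    douterRate_le_unif hd0 ha hL hK hn hγ1 hc₀.le
  have hρ_eq : ρ = ((P.L : ℝ) ^ (-(γ / 2))) ^ P.K := rpow_neg_natPow P.L P.K (γ / 2)
  -- expand in the datum and sum
  rw [datum_expand]
  calc _ ≤ ∑ bt, |ψ bt * (((P.L ^ P.K : ℕ) : ℝ) *
          ((minimiser (P.L ^ P.K) M (aK a P.L P.K) (((P.L ^ P.K : ℕ) : ℝ) ^ 2) m2 (Pi.single bt 1) x1
              - (((Finset.univ.filter fun y : Tor (fine (P.L ^ n * P.L ^ P.K) M) =>
                    ∀ ν, (x1 ν).val = (y ν).val / P.L ^ n).card : ℝ))⁻¹ *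
                ∑ y ∈ (Finset.univ.filter fun y : Tor (fine (P.L ^ n * P.L ^ P.K) M) =>
                    ∀ ν, (x1 ν).val = (y ν).val / P.L ^ n),
                  minimiser (P.L ^ n * P.L ^ P.K) M (aK a P.L (P.K + n)) (((P.L ^ n * P.L ^ P.K : ℕ) : ℝ) ^ 2) m2
                    (Pi.single bt 1) y)
            - (minimiser (P.L ^ P.K) M (aK a P.L P.K) (((P.L ^ P.K : ℕ) : ℝ) ^ 2) m2 (Pi.single bt 1) xt
              - (((Finset.univ.filter fun x' : Tor (fine (P.L ^ n * P.L ^ P.K) M) =>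
                    ∀ ν, (xt ν).val = (x' ν).val / P.L ^ n).card : ℝ))⁻¹ *
                ∑ x' ∈ (Finset.univ.filter fun x' : Tor (fine (P.L ^ n * P.L ^ P.K) M) =>
                    ∀ ν, (xt ν).val = (x' ν).val / P.L ^ n),
                  minimiser (P.L ^ n * P.L ^ P.K) M (aK a P.L (P.K + n)) (((P.L ^ n * P.L ^ P.K : ℕ) : ℝ) ^ 2) m2
                    (Pi.single bt 1) x')))| := Finset.abs_sum_le_sum_abs _ _
    _ ≤ ∑ bt, S * (Rk * (E₀ xt bt + E₀ x1 bt) + c₁ * ρ * (E₁ x1 bt + E₁ xt bt)) := by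
        refine Finset.sum_le_sum fun bt _ => ?_
        rw [abs_mul]
        exact mul_le_mul (hS bt) (hker bt) (abs_nonneg _) hS0
    _ = S * ∑ bt, (Rk * (E₀ xt bt + E₀ x1 bt) + c₁ * ρ * (E₁ x1 bt + E₁ xt bt)) := by rw [Finset.mul_sum]
    _ ≤ S * (Rk * (2 * latticeConst P.d (δ₀ / 2)) + c₁ * ρ * (2 * latticeConst P.d δ₁)) :=
        mul_le_mul_of_nonneg_left hβsum hS0
    _ ≤ S * (Real.sqrt (2 * (a * c₀) *
          (dprop38RateConst a a (a * (2 * ((a * (1 - ((P.L : ℝ) ^ 2)⁻¹))⁻¹ + π ^ 2 / 48 + 1 / 3))) ((π ^ 2 / 4) ^ P.d) P.d γ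
            + dprop38PosConst a ((π ^ 2 / 4) ^ P.d) P.d γ)) * ((P.L : ℝ) ^ (-(γ / 2))) ^ P.K
          * (2 * latticeConst P.d (δ₀ / 2)) + c₁ * ((P.L : ℝ) ^ (-(γ / 2))) ^ P.K * (2 * latticeConst P.d δ₁)) := by
        rw [← hρ_eq] at hRk_le ⊢
        have hK0 : 0 ≤ 2 * latticeConst P.d (δ₀ / 2) := by
          have := latticeConst_nonneg P.d (by positivity : (0 : ℝ) ≤ δ₀ / 2); linarith
        exact mul_le_mul_of_nonneg_left (add_le_add (mul_le_mul_of_nonneg_right hRk_le hK0) le_rfl) hS0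
    _ = _ := by ring

/-! ## §2 ★★ The NE3 pattern in King's model: value AND first difference of the two-run discrepancy, one constant -/

/-- ★★ **THE NE3 PATTERN IN KING's MODEL — VALUE AND FIRST DIFFERENCE OF THE TWO-RUN DISCREPANCY, ONE LEVEL- AND VOLUME-FREE CONSTANT.**
For `d ≥ 1`, odd `L ≥ 2`, `a, m² > 0`, `0 < γ < 1` there is `C ≥ 0` (a function of `d, L, a, m², γ` only) such that for EVERY volume
`P = (d, L, m, K)` of the `B1∕B4` tower with `K ≥ 1`, every `n ≥ 1`, every datum `|ψ| ≤ S`, every coarse point `x` and direction `μ`, the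
two-run discrepancy `D = φ_K^ψ − Q_nφ_{K+n}^ψ` (run A's minimiser minus run B's minimiser block-averaged back) obeys
`|D(x)| ≤ C·(L^{−γ∕2})^K·S` (generation 7's `N16KingModel.twoRun_minimiser_blockMean_le_sup`) AND
`|D(x + e_μ) − D(x)| ≤ C·(L^K)⁻¹·(L^{−γ∕2})^K·S` (§1 divided by `η⁻¹ = L^K`): the first difference is ONE POWER OF THE LATTICE SPACING
`ξ = L^{−K}` smaller than the value — the scalar template of NE3's pair «value of `Z`» + (Lip₁ᶜ) «`‖Ad(W)Z(x + e_μ) − Z(x)‖ ≤ Λ₁ξ²`».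
[cite: King1986, Prop. 3.8 (3.71) p.664 (lines 1, 2, 4), Thm 3.3 p.658, p.674] -/
theorem twoRun_value_and_firstDiff_le_sup (dd L : ℕ) (hd : 1 ≤ dd) (hLodd : Odd L) (hL : 2 ≤ L) {a m2 : ℝ} (ha : 0 < a)
    (hm : 0 < m2) {γ : ℝ} (hγ0 : 0 < γ) (hγ1 : γ < 1) :
    ∃ C : ℝ, 0 ≤ C ∧
      ∀ (P : Params) (_hPd : P.d = dd) (_hPL : P.L = L) (_hK : 1 ≤ P.K) [NeZero P.L]
      (n : ℕ) (_hn : 1 ≤ n) (M : Fin P.d → ℕ) [∀ μ, NeZero (M μ)] (_hMK : ∀ μ, M μ = P.sitesPerDir P.K)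
      (ψ : Tor M → ℝ) (S : ℝ) (_hS : ∀ b, |ψ b| ≤ S) (xt : Tor (fine (P.L ^ P.K) M)) (μ : Fin P.d),
      |minimiser (P.L ^ P.K) M (aK a P.L P.K) (((P.L ^ P.K : ℕ) : ℝ) ^ 2) m2 ψ xt
          - (((Finset.univ.filter fun x' : Tor (fine (P.L ^ n * P.L ^ P.K) M) =>
                ∀ ν, (xt ν).val = (x' ν).val / P.L ^ n).card : ℝ))⁻¹ *
            ∑ x' ∈ (Finset.univ.filter fun x' : Tor (fine (P.L ^ n * P.L ^ P.K) M) =>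
                ∀ ν, (xt ν).val = (x' ν).val / P.L ^ n),
              minimiser (P.L ^ n * P.L ^ P.K) M (aK a P.L (P.K + n)) (((P.L ^ n * P.L ^ P.K : ℕ) : ℝ) ^ 2) m2 ψ x'|
        ≤ C * ((L : ℝ) ^ (-(γ / 2))) ^ P.K * S ∧
      |(minimiser (P.L ^ P.K) M (aK a P.L P.K) (((P.L ^ P.K : ℕ) : ℝ) ^ 2) m2 ψ (xt + unitVec (fine (P.L ^ P.K) M) μ)
            - (((Finset.univ.filter fun y : Tor (fine (P.L ^ n * P.L ^ P.K) M) =>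
                  ∀ ν, ((xt + unitVec (fine (P.L ^ P.K) M) μ) ν).val = (y ν).val / P.L ^ n).card : ℝ))⁻¹ *
              ∑ y ∈ (Finset.univ.filter fun y : Tor (fine (P.L ^ n * P.L ^ P.K) M) =>
                  ∀ ν, ((xt + unitVec (fine (P.L ^ P.K) M) μ) ν).val = (y ν).val / P.L ^ n),
                minimiser (P.L ^ n * P.L ^ P.K) M (aK a P.L (P.K + n)) (((P.L ^ n * P.L ^ P.K : ℕ) : ℝ) ^ 2) m2 ψ y)
          - (minimiser (P.L ^ P.K) M (aK a P.L P.K) (((P.L ^ P.K : ℕ) : ℝ) ^ 2) m2 ψ xt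
            - (((Finset.univ.filter fun x' : Tor (fine (P.L ^ n * P.L ^ P.K) M) =>
                  ∀ ν, (xt ν).val = (x' ν).val / P.L ^ n).card : ℝ))⁻¹ *
              ∑ x' ∈ (Finset.univ.filter fun x' : Tor (fine (P.L ^ n * P.L ^ P.K) M) =>
                  ∀ ν, (xt ν).val = (x' ν).val / P.L ^ n),
                minimiser (P.L ^ n * P.L ^ P.K) M (aK a P.L (P.K + n)) (((P.L ^ n * P.L ^ P.K : ℕ) : ℝ) ^ 2) m2 ψ x')|
        ≤ C * (((L : ℝ) ^ P.K))⁻¹ * ((L : ℝ) ^ (-(γ / 2))) ^ P.K * S := by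
  obtain ⟨δ₀, c₀, hδ₀, hc₀, HV⟩ := twoRun_minimiser_blockMean_le_sup dd L hd hLodd hL ha hm hγ0.le hγ1.le
  obtain ⟨δ₀', c₀', δ₁, c₁, hδ₀', hc₀', hδ₁, hc₁, HD⟩ := twoRunDeriv_minimiser_blockMean_le_sup dd L hd hLodd hL ha hm hγ0 hγ1
  set CV : ℝ := Real.sqrt (2 * (a * c₀) *
      (prop38RateConst a a (a * (2 * ((a * (1 - ((L : ℝ) ^ 2)⁻¹))⁻¹ + π ^ 2 / 48 + 1 / 3))) ((π ^ 2 / 4) ^ dd) dd γ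
        + prop38PosConst a ((π ^ 2 / 4) ^ dd) dd γ)) * latticeConst dd (δ₀ / 2) with hCV
  set CD : ℝ := (2 * Real.sqrt (2 * (a * c₀') *
      (dprop38RateConst a a (a * (2 * ((a * (1 - ((L : ℝ) ^ 2)⁻¹))⁻¹ + π ^ 2 / 48 + 1 / 3))) ((π ^ 2 / 4) ^ dd) dd γ
        + dprop38PosConst a ((π ^ 2 / 4) ^ dd) dd γ)) * latticeConst dd (δ₀' / 2) + 2 * c₁ * latticeConst dd δ₁) with hCD
  have hCV0 : 0 ≤ CV := mul_nonneg (Real.sqrt_nonneg _) (latticeConst_nonneg dd (by positivity))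
  have hCD0 : 0 ≤ CD := add_nonneg (mul_nonneg (mul_nonneg (by norm_num) (Real.sqrt_nonneg _))
    (latticeConst_nonneg dd (by positivity))) (mul_nonneg (by positivity) (latticeConst_nonneg dd hδ₁.le))
  refine ⟨max CV CD, le_max_of_le_left hCV0, ?_⟩
  intro P hPd hPL hK _ n hn M _ hMK ψ S hS xt μ
  have hV := HV P hPd hPL hK n hn M hMK ψ S hS xt
  have hD := HD P hPd hPL hK n hn M hMK ψ S hS xt μ
  subst hPd hPL
  have hS0 : 0 ≤ S := (abs_nonneg _).trans (hS 0)
  have hθ : 0 ≤ ((P.L : ℝ) ^ (-(γ / 2))) ^ P.K := pow_nonneg (kingTheta_pos (by omega) (γ / 2)).le _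
  have hNpos : (0 : ℝ) < ((P.L ^ P.K : ℕ) : ℝ) := by exact_mod_cast pow_pos (show 0 < P.L by omega) P.K
  have hNcast : ((P.L ^ P.K : ℕ) : ℝ) = (P.L : ℝ) ^ P.K := by push_cast; ring
  refine ⟨hV.trans (mul_le_mul_of_nonneg_right (mul_le_mul_of_nonneg_right (le_max_left _ _) hθ) hS0), ?_⟩
  rw [abs_mul, abs_of_pos hNpos] at hD
  have h1 := (le_div_iff₀' hNpos).mpr hD
  have hY : 0 ≤ ((P.L : ℝ) ^ P.K)⁻¹ * ((P.L : ℝ) ^ (-(γ / 2))) ^ P.K * S :=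
    mul_nonneg (mul_nonneg (inv_nonneg.2 (by positivity)) hθ) hS0
  refine h1.trans ?_
  calc _ = CD * (((P.L : ℝ) ^ P.K)⁻¹ * ((P.L : ℝ) ^ (-(γ / 2))) ^ P.K * S) := by rw [hNcast]; ring
    _ ≤ max CV CD * (((P.L : ℝ) ^ P.K)⁻¹ * ((P.L : ℝ) ^ (-(γ / 2))) ^ P.K * S) :=
        mul_le_mul_of_nonneg_right (le_max_right _ _) hY
    _ = _ := by ring

end Summit.QuantumFields.YangMills.BalabanUVNodes.N16KingModelDerivSup

end
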